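import Mathlib.Analysis.Calculus.LocalExtr.Basic
import Mathlib.Analysis.Calculus.Deriv.Polynomial
import Mathlib.Topology.Order.IntermediateValue
import Mathlib.Topology.Algebra.MvPolynomial
import Mathlib.Algebra.Polynomial.Roots
import Mathlib.Algebra.MvPolynomial.Equiv
import HarnessLib

/-!
# Grid cubes and zeros of polynomials: one-dimensional counting tools

Tools for the *grid lemma* of `HypersurfaceGridCount.lean` (a real hypersurface of degree `≤ d` in
`ℝ^{m+1}` meets at most `c(m,d) · n^m` of the `n^{m+1}` closed cubes of a cubical grid), which is the
effective-convergence step in Yoshinaga's proof that real periods are elementary real numbers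
(arXiv:0805.0349, Lemma 29, there obtained from Minkowski-content estimates; here replaced by an
elementary slicing argument).

* `gridCube x₀ h k` — the closed cube `∏ᵢ [x₀ᵢ + h kᵢ, x₀ᵢ + h (kᵢ + 1)]` of the grid with origin `x₀` and
  mesh `h`, and its description after splitting off the coordinate `0` (`Fin.cons`).
* `exists_eval_eq_zero_of_le_of_le` — a polynomial taking a nonpositive and a nonnegative value on a grid
  cube vanishes somewhere on it (intermediate value theorem on a segment).
* `exists_isRoot_derivative_of_sign` — a real polynomial with the same nonzero sign at `a < b` and a root
  in between has a critical point in `(a, b)` (interior extremum).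
* `card_filter_exists_root_Ioo_le`, `card_filter_isRoot_level_le` — a nonzero real polynomial has a
  root in at most `natDegree` of the open mesh intervals, resp. vanishes at at most `natDegree` of the
  grid levels.

## References

* M. Yoshinaga, *Periods and elementary real numbers*, arXiv:0805.0349 (2008), §3.4 (the cubes
  `C_n(k_1, …, k_ℓ)`), Lemma 29.
-/

noncomputable section

open Set Polynomial

namespace Literature.NumberTheory.Transcendental

/-! ### Grid cubes -/

/-- The closed grid cube `C(k) = ∏ᵢ [x₀ᵢ + h·kᵢ, x₀ᵢ + h·(kᵢ+1)] ⊆ ℝ^N` with multi-index `k`, for the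
cubical grid of origin `x₀` and mesh `h` (Yoshinaga's `C_n(k_1,…,k_ℓ)` is the case `x₀ = 0`,
`h = r/n`). [cite: Yoshinaga2008, §3.4] -/
def gridCube {N : ℕ} (x₀ : Fin N → ℝ) (h : ℝ) (k : Fin N → ℕ) : Set (Fin N → ℝ) :=
  Icc (fun i => x₀ i + h * k i) (fun i => x₀ i + h * (k i + 1))

variable {N : ℕ}

/-- Membership in a grid cube, coordinatewise. [folklore] -/
theorem mem_gridCube_iff {x₀ : Fin N → ℝ} {h : ℝ} {k : Fin N → ℕ} {x : Fin N → ℝ} :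
    x ∈ gridCube x₀ h k ↔ ∀ i, x₀ i + h * k i ≤ x i ∧ x i ≤ x₀ i + h * (k i + 1) := by
  simp only [gridCube, mem_Icc, Pi.le_def, forall_and]

/-- The lower corner of a grid cube belongs to it (for nonnegative mesh). [folklore] -/
theorem corner_mem_gridCube (x₀ : Fin N → ℝ) {h : ℝ} (hh : 0 ≤ h) (k : Fin N → ℕ) :
    (fun i => x₀ i + h * k i) ∈ gridCube x₀ h k :=
  mem_gridCube_iff.2 fun i => ⟨le_rfl, by nlinarith⟩

/-- Splitting off the coordinate `0`: `Fin.cons t y` lies in the cube of index `Fin.cons j k` iff `t`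
lies in the `j`-th mesh interval and `y` lies in the cube of index `k` of the grid of tails.
[folklore] -/
theorem cons_mem_gridCube_cons_iff {t₀ : ℝ} {y₀ : Fin N → ℝ} {h : ℝ} {j : ℕ} {k : Fin N → ℕ}
    {t : ℝ} {y : Fin N → ℝ} :
    (Fin.cons t y : Fin (N + 1) → ℝ) ∈ gridCube (Fin.cons t₀ y₀) h (Fin.cons j k) ↔
      (t₀ + h * j ≤ t ∧ t ≤ t₀ + h * (j + 1)) ∧ y ∈ gridCube y₀ h k := by
  simp only [mem_gridCube_iff, Fin.forall_fin_succ, Fin.cons_zero, Fin.cons_succ]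

/-- Splitting off the coordinate `0`, for an arbitrary point. [folklore] -/
theorem mem_gridCube_cons_iff {t₀ : ℝ} {y₀ : Fin N → ℝ} {h : ℝ} {j : ℕ} {k : Fin N → ℕ}
    {x : Fin (N + 1) → ℝ} :
    x ∈ gridCube (Fin.cons t₀ y₀) h (Fin.cons j k) ↔
      (t₀ + h * j ≤ x 0 ∧ x 0 ≤ t₀ + h * (j + 1)) ∧ Fin.tail x ∈ gridCube y₀ h k := by
  rw [← Fin.cons_self_tail x, cons_mem_gridCube_cons_iff]
  simp

/-- Grid cubes are convex along segments: `y + s (z - y)` stays in the cube for `s ∈ [0, 1]`.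
[folklore] -/
theorem segment_mem_gridCube {x₀ : Fin N → ℝ} {h : ℝ} {k : Fin N → ℕ} {y z : Fin N → ℝ}
    (hy : y ∈ gridCube x₀ h k) (hz : z ∈ gridCube x₀ h k) {s : ℝ} (hs0 : 0 ≤ s) (hs1 : s ≤ 1) :
    y + s • (z - y) ∈ gridCube x₀ h k := by
  rw [mem_gridCube_iff] at hy hz ⊢
  intro i
  obtain ⟨hy1, hy2⟩ := hy i
  obtain ⟨hz1, hz2⟩ := hz i
  simp only [Pi.add_apply, Pi.smul_apply, Pi.sub_apply, smul_eq_mul]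
  constructor <;> nlinarith

/-- Grid cubes are compact. [folklore] -/
theorem isCompact_gridCube (x₀ : Fin N → ℝ) (h : ℝ) (k : Fin N → ℕ) :
    IsCompact (gridCube x₀ h k) :=
  isCompact_Icc

/-- **Intermediate values on a cube.** If a real polynomial takes a nonpositive value and a nonnegative
value on a grid cube, it vanishes somewhere on the cube (intermediate value theorem along the segment).
[folklore] -/
theorem exists_eval_eq_zero_of_le_of_le {x₀ : Fin N → ℝ} {h : ℝ} {k : Fin N → ℕ}
    (Q : MvPolynomial (Fin N) ℝ) {y z : Fin N → ℝ} (hy : y ∈ gridCube x₀ h k)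
    (hz : z ∈ gridCube x₀ h k) (hQy : MvPolynomial.eval y Q ≤ 0) (hQz : 0 ≤ MvPolynomial.eval z Q) :
    ∃ w ∈ gridCube x₀ h k, MvPolynomial.eval w Q = 0 := by
  set φ : ℝ → ℝ := fun s => MvPolynomial.eval (y + s • (z - y)) Q with hφ
  have hcont : Continuous φ :=
    (MvPolynomial.continuous_eval Q).comp (continuous_const.add (continuous_id.smul continuous_const))
  have h0 : φ 0 = MvPolynomial.eval y Q := by simp [hφ]
  have h1 : φ 1 = MvPolynomial.eval z Q := by simp [hφ]
  have hmem : (0 : ℝ) ∈ Icc (φ 0) (φ 1) := ⟨by rw [h0]; exact hQy, by rw [h1]; exact hQz⟩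
  obtain ⟨s, hs, hs0⟩ := intermediate_value_Icc zero_le_one hcont.continuousOn hmem
  exact ⟨y + s • (z - y), segment_mem_gridCube hy hz hs.1 hs.2, hs0⟩

/-- **Sign constancy on a cube.** If a real polynomial has no zero on a grid cube, it has the same sign
at any two of its points. [folklore] -/
theorem eval_pos_iff_of_forall_ne_zero {x₀ : Fin N → ℝ} {h : ℝ} {k : Fin N → ℕ}
    (Q : MvPolynomial (Fin N) ℝ) (hQ : ∀ w ∈ gridCube x₀ h k, MvPolynomial.eval w Q ≠ 0)
    {y z : Fin N → ℝ} (hy : y ∈ gridCube x₀ h k) (hz : z ∈ gridCube x₀ h k) :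
    0 < MvPolynomial.eval y Q ↔ 0 < MvPolynomial.eval z Q := by
  constructor <;> intro hpos <;> by_contra! hle
  · obtain ⟨w, hw, hw0⟩ := exists_eval_eq_zero_of_le_of_le Q hz hy hle hpos.le
    exact hQ w hw hw0
  · obtain ⟨w, hw, hw0⟩ := exists_eval_eq_zero_of_le_of_le Q hy hz hle hpos.le
    exact hQ w hw hw0

/-! ### One-variable tools -/

/-- **Interior critical point.** If a real polynomial `g` has the same nonzero sign at `a < b`
(`0 < g(a) g(b)`) and a root in `(a, b)`, then `g'` has a root in `(a, b)`: `g` attains an interior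
extremum on `[a, b]`. [folklore] -/
theorem exists_isRoot_derivative_of_sign (g : ℝ[X]) {a b : ℝ} (hab : a < b)
    (hsign : 0 < g.eval a * g.eval b) {t : ℝ} (ht : t ∈ Ioo a b) (hroot : g.IsRoot t) :
    ∃ s ∈ Ioo a b, g.derivative.IsRoot s := by
  have hcont : ContinuousOn (fun x => g.eval x) (Icc a b) := g.differentiable.continuous.continuousOn
  have hne : (Icc a b).Nonempty := nonempty_Icc.2 hab.le
  have htI : t ∈ Icc a b := Ioo_subset_Icc_self ht
  rcases mul_pos_iff.1 hsign with ⟨ha, hb⟩ | ⟨ha, hb⟩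
  · -- `0 < g a`, `0 < g b`: interior minimum
    obtain ⟨c, hc, hcmin⟩ := isCompact_Icc.exists_isMinOn hne hcont
    have hct : g.eval c ≤ g.eval t := hcmin htI
    rw [hroot.eq_zero] at hct
    have hca : c ≠ a := fun h => by rw [h] at hct; exact absurd hct ha.not_ge
    have hcb : c ≠ b := fun h => by rw [h] at hct; exact absurd hct hb.not_ge
    have hc' : c ∈ Ioo a b := ⟨lt_of_le_of_ne hc.1 (Ne.symm hca), lt_of_le_of_ne hc.2 hcb⟩
    have hloc : IsLocalMin (fun x => g.eval x) c :=
      hcmin.isLocalMin (Icc_mem_nhds hc'.1 hc'.2)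
    exact ⟨c, hc', hloc.hasDerivAt_eq_zero (g.hasDerivAt c)⟩
  · -- `g a < 0`, `g b < 0`: interior maximum
    obtain ⟨c, hc, hcmax⟩ := isCompact_Icc.exists_isMaxOn hne hcont
    have hct : g.eval t ≤ g.eval c := hcmax htI
    rw [hroot.eq_zero] at hct
    have hca : c ≠ a := fun h => by rw [h] at hct; exact absurd hct ha.not_ge
    have hcb : c ≠ b := fun h => by rw [h] at hct; exact absurd hct hb.not_ge
    have hc' : c ∈ Ioo a b := ⟨lt_of_le_of_ne hc.1 (Ne.symm hca), lt_of_le_of_ne hc.2 hcb⟩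
    have hloc : IsLocalMax (fun x => g.eval x) c :=
      hcmax.isLocalMax (Icc_mem_nhds hc'.1 hc'.2)
    exact ⟨c, hc', hloc.hasDerivAt_eq_zero (g.hasDerivAt c)⟩

/-- **Roots in mesh intervals.** A nonzero real polynomial has a root in at most `natDegree` of the
pairwise disjoint open mesh intervals `(t₀ + h j, t₀ + h (j+1))`, `j < n` (`h > 0`). [folklore] -/
theorem card_filter_exists_root_Ioo_le (g : ℝ[X]) (hg : g ≠ 0) (t₀ : ℝ) {h : ℝ} (hh : 0 < h)
    (n : ℕ) [DecidablePred fun j : Fin n => ∃ t ∈ Ioo (t₀ + h * j) (t₀ + h * (j + 1)), g.IsRoot t] :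
    (Finset.univ.filter fun j : Fin n =>
        ∃ t ∈ Ioo (t₀ + h * j) (t₀ + h * (j + 1)), g.IsRoot t).card ≤ g.natDegree := by
  classical
  set S := Finset.univ.filter fun j : Fin n =>
    ∃ t ∈ Ioo (t₀ + h * j) (t₀ + h * (j + 1)), g.IsRoot t with hS
  -- choose a root in each interval
  have hch : ∀ j ∈ S, ∃ t ∈ Ioo (t₀ + h * j) (t₀ + h * (j + 1)), g.IsRoot t := fun j hj => by
    simpa [hS] using hj
  choose! ρ hρ using hch
  calc S.card ≤ g.roots.toFinset.card := by
        refine Finset.card_le_card_of_injOn ρ (fun j hj => ?_) (fun j hj j' hj' hjj' => ?_)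
        · have := (hρ j hj).2
          simpa [Multiset.mem_toFinset, mem_roots hg] using this
        · -- roots in disjoint intervals coincide only for equal indices
          have h1 := (hρ j hj).1
          have h2 := (hρ j' hj').1
          rw [hjj'] at h1
          by_contra hne
          rcases lt_or_gt_of_ne (fun h : (j : ℕ) = j' => hne (Fin.ext h)) with hlt | hlt
          · have : (j : ℝ) + 1 ≤ j' := by exact_mod_cast hlt
            have := h1.2; have := h2.1; nlinarith
          · have : (j' : ℝ) + 1 ≤ j := by exact_mod_cast hlt
            have := h1.1; have := h2.2; nlinarith
    _ ≤ g.roots.card := Multiset.toFinset_card_le _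
    _ ≤ g.natDegree := g.card_roots'

/-- **Roots at grid levels.** A nonzero real polynomial vanishes at at most `natDegree` of the grid
levels `t₀ + h (j + e)`, `j < n` (`h > 0`, `e` a fixed offset, in practice `0` or `1`). [folklore] -/
theorem card_filter_isRoot_level_le (g : ℝ[X]) (hg : g ≠ 0) (t₀ : ℝ) {h : ℝ} (hh : 0 < h) (e : ℝ)
    (n : ℕ) [DecidablePred fun j : Fin n => g.IsRoot (t₀ + h * (j + e))] :
    (Finset.univ.filter fun j : Fin n => g.IsRoot (t₀ + h * (j + e))).card ≤ g.natDegree := by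
  classical
  calc (Finset.univ.filter fun j : Fin n => g.IsRoot (t₀ + h * (j + e))).card
        ≤ g.roots.toFinset.card := by
        refine Finset.card_le_card_of_injOn (fun j : Fin n => t₀ + h * (j + e)) (fun j hj => ?_)
          (fun j _ j' _ hjj' => ?_)
        · simp only [Finset.coe_filter, Finset.mem_univ, true_and, mem_setOf_eq] at hj
          simpa [Multiset.mem_toFinset, mem_roots hg] using hj
        · have : (j : ℝ) = j' := by
            have := hjj'
            simp only at this
            nlinarith
          exact Fin.ext (by exact_mod_cast this)
    _ ≤ g.roots.card := Multiset.toFinset_card_le _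
    _ ≤ g.natDegree := g.card_roots'

end Literature.NumberTheory.Transcendental
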